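import Summits.FinalStateConjecture.FinalStateConjecture.Theorems.ZeroEnergyKerrOrBombStationaryLimitReductionRecutCoveringJunctionCore
import Literature.Geometry.Lorentzian.CausalFutureProofs
import HarnessLib

/-!
# Route ZeroEnergyKerrOrBomb · crux `FinalStateFromKerrOrBomb` (stmt-FinalStateConjecture-17839), line `SketchIdeator1` —
# stub `stub_recutJunctionCore` (`Sig7.stub_recutJunctionCore := RecutJunctionCore`, p125072): the closed first step
# and the no-hole case

Helper file (`--supports stmt-FinalStateConjecture-17839`; registered helpers `docHole_causalPast_flatSlab`,
`docHole_subset_causalPast_recutCertifiedLate`, `recutJunctionCore_of_N_eq_zero`) of the lead's wave-1 stub worker for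
`stub_recutJunctionCore` (2026-08-17). The stub is the source-free JUNCTION CORE `RecutJunctionCore` of the Kerr–Schild
recut (`…RecutCoveringJunctionCore.lean`): for `s, W` beyond a threshold and every late chart time `τ₁`,
`(J⁻(docHoleSlabs d R τ₁) ∪ docHoleTubes d R τ₁) \ recutCertifiedLate R' τ₁ ⊆ J⁻(recutCertifiedSlab R' τ₁)` at the
transported radii `R'ᵢ τ = Rᵢ (cᵢ τ − s) − W`.

What this file lands (elementary, closed):

* §1 the old d.o.c. hole slabs / tubes at `τ₁ > τ₀` consist of LATE d.o.c.-part chart points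
  (`docHoleSlabs_subset_iUnion`, `docHoleTubes_subset_iUnion`); with no hole they are empty.
* §2 `J⁻(∅) = ∅`; `J⁻` is transitive on sets (`causalPast_subset_causalPast_of_subset`, from the tree's
  `LorentzianMetric.causalFuture_causalFuture_eq`, O'Neill 1983, Ch. 14, p. 402).
* §3 `docHole_causalPast_flatSlab` — THE FIRST STEP OF THE JUNCTION: under `IsHorizonNormalised d`, every point of the
  left-hand side `J⁻(docHoleSlabs d R τ₁) ∪ docHoleTubes d R τ₁` (`τ₁ > τ₀`) lies in `J⁻` of arbitrarily late flat slabs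
  `Ψ₀({x⁰ = σ})`, `σ ≥ σ₀` (horizon normalisation of the slab / tube point, then transitivity of `J⁻`); hence
  (`docHole_subset_causalPast_recutCertifiedLate`) it lies in `J⁻(recutCertifiedLate d M a Θ R' τ₁)` for EVERY choice of
  `M, a, Θ, R'` (a flat slab of time `σ > τ₁` is recut-certified late). So on its left-hand side the junction core is
  exactly the PAST-BOUNDARY property of the recut certified late region `Ω(τ₁)`:
  `J⁻(Ω(τ₁)) \ Ω(τ₁) ⊆ J⁻(Σ(τ₁))`, `Σ(τ₁) = recutCertifiedSlab R' τ₁` — a future causal curve entering `Ω(τ₁)` does so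
  through the slab `Σ(τ₁)` or from a point that flows into `Σ(τ₁)` inside its own column.
* §4 `recutJunctionCore_of_N_eq_zero` — the registered text with the extra hypothesis `d.N = 0` (no hole: both hole sets
  are empty, `J⁻(∅) = ∅`, the inclusion is `∅ ⊆ _`).

What is NOT here (worker report to the lead). No junk route exists for `N ≥ 1`: the thresholds `s₁ ≤ s`, `s₁ ≤ W` only
SHRINK `R'`, and `τJ` is chosen after `s, W`, so `R'ᵢ τ₁ → ∞` on the late times quantified (the recut slabs are not
empty, the recut tubes do not absorb the shell `R' < r ≤ R`); under `IsKerrChartedWith` the d.o.c. parts are the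
non-empty, time-translation invariant sets `Pᵢ(Θᵢ(Kerr.exterior))`, so `docHoleTubes d R τ₁ ≠ ∅` for all `τ₁`. The
honest proof orients model flows in the charts (`dψ(Λ V_{M,a})`, `dΨ₀(∂₀)` FUTURE-directed for `τ_𝒟`): their eventual
timelikeness follows from the `C⁰` part of the convergence (p136225), but their SIGN is not among the hypotheses of
`RecutJunctionCore` (no clause relates `𝒟.timeOrientation` to the charts; `IsHorizonNormalised` and clause (ii) pin it
only in honest models). References: Dafermos–Luk arXiv:1710.01722, Conjecture 1 (b)–(c); O'Neill 1983, Ch. 14,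
pp. 402–403.
-/

-- every `Summit.FinalStateConjecture.FinalStateConjecture.…` name repeats the summit = sub-problem segment (D-0017 layout)
set_option linter.dupNamespace false

noncomputable section

open scoped Manifold ContDiff Topology ENNReal
open Set Filter Function Literature.Geometry.Lorentzian

namespace Summit.FinalStateConjecture.FinalStateConjecture.Theorems.SymplecticDualOfTheBomb

open Summit.FinalStateConjecture.FinalStateConjecture.Theorems.OneLockedExplosion

/-! ## §1 The old d.o.c. hole sets consist of late d.o.c.-part chart points; no hole -/

section Sets

variable {𝓢 : Spacetime.{0} 4} {O : Set 𝓢.carrier} {k : ℕ}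

/-- The old d.o.c. hole slabs at a chart time `τ₁ > τ₀` consist of late d.o.c.-part chart points. [folklore] -/
theorem docHoleSlabs_subset_iUnion (d : StationaryFinalStateDecomposition 𝓢 O k) (R : Fin d.N → ℝ → ℝ) {τ₁ : ℝ}
    (hτ : d.toOver.τ₀ < τ₁) :
    docHoleSlabs d R τ₁ ⊆ ⋃ i, d.toOver.chart i '' ((d.background i).lateRegion d.toOver.τ₀ ∩ docPart d i) :=
  iUnion_mono fun _ ↦ image_mono fun _ hx ↦ ⟨lt_of_lt_of_eq hτ hx.1.1.symm, hx.2⟩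

/-- The old d.o.c.-certified hole tubes after a chart time `τ₁ ≥ τ₀` consist of late d.o.c.-part chart points.
[folklore] -/
theorem docHoleTubes_subset_iUnion (d : StationaryFinalStateDecomposition 𝓢 O k) (R : Fin d.N → ℝ → ℝ) {τ₁ : ℝ}
    (hτ : d.toOver.τ₀ ≤ τ₁) :
    docHoleTubes d R τ₁ ⊆ ⋃ i, d.toOver.chart i '' ((d.background i).lateRegion d.toOver.τ₀ ∩ docPart d i) :=
  iUnion_mono fun _ ↦ image_mono fun _ hx ↦ ⟨lt_of_le_of_lt hτ hx.1.1, hx.2⟩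

/-- With no hole the old d.o.c. hole slabs are empty. [folklore] -/
theorem docHoleSlabs_eq_empty (d : StationaryFinalStateDecomposition 𝓢 O k) [IsEmpty (Fin d.N)]
    (R : Fin d.N → ℝ → ℝ) (τ₁ : ℝ) : docHoleSlabs d R τ₁ = ∅ :=
  iUnion_of_empty _

/-- With no hole the old d.o.c.-certified hole tubes are empty. [folklore] -/
theorem docHoleTubes_eq_empty (d : StationaryFinalStateDecomposition 𝓢 O k) [IsEmpty (Fin d.N)]
    (R : Fin d.N → ℝ → ℝ) (τ₁ : ℝ) : docHoleTubes d R τ₁ = ∅ :=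
  iUnion_of_empty _

end Sets

/-! ## §2 Causal preliminaries -/

section Causal

variable {E : Type*} [NormedAddCommGroup E] [NormedSpace ℝ E] {H : Type*} [TopologicalSpace H]
  {I : ModelWithCorners ℝ E H} {n : ℕ∞ω} {M : Type*} [TopologicalSpace M] [ChartedSpace H M]
  [IsManifold I ∞ M] {g : LorentzianMetric I n M} {τ : TimeOrientation g}

/-- `J⁻(∅) = ∅` (`J⁻` is computed pointwise). O'Neill 1983, Ch. 14, p. 403. [folklore] -/
theorem causalPast_empty : g.causalPast τ (∅ : Set M) = ∅ := by
  ext q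
  simp only [LorentzianMetric.causalPast, LorentzianMetric.mem_causalFuture_iff, mem_empty_iff_false, false_and,
    exists_false, or_self]

/-- A point of `J⁻(S)` is in `J⁻` of a single point of `S`. O'Neill 1983, Ch. 14, p. 403. [folklore] -/
theorem exists_mem_causalPast_singleton_of_mem_causalPast {S : Set M} {p : M} (hp : p ∈ g.causalPast τ S) :
    ∃ q ∈ S, p ∈ g.causalPast τ ({q} : Set M) := by
  rcases hp with hp | ⟨q, hq, h⟩
  · exact ⟨p, hp, LorentzianMetric.subset_causalPast g τ _ (mem_singleton p)⟩
  · exact ⟨q, hq, Or.inr ⟨q, mem_singleton q, h⟩⟩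

/-- **Transitivity of `J⁻` for sets** on a manifold without boundary with a `C²` metric: `T ⊆ J⁻(S)` implies
`J⁻(T) ⊆ J⁻(S)` (`J⁻(J⁻(S)) = J⁻(S)`, the time dual of `LorentzianMetric.causalFuture_causalFuture_eq`).
O'Neill 1983, Ch. 14, p. 402. [folklore] -/
theorem causalPast_subset_causalPast_of_subset [BoundarylessManifold I M] (hn : 2 ≤ n) {S T : Set M}
    (hT : T ⊆ g.causalPast τ S) : g.causalPast τ T ⊆ g.causalPast τ S := fun p hp ↦ by
  have h : p ∈ g.causalFuture τ.reverse (g.causalFuture τ.reverse S) := LorentzianMetric.causalFuture_mono hT hp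
  rwa [LorentzianMetric.causalFuture_causalFuture_eq hn S] at h

end Causal

/-! ## §3 The first step of the junction: the left-hand side reaches arbitrarily late flat slabs -/

/-- **Registered helper `docHole_causalPast_flatSlab` — the left-hand side of the junction core reaches arbitrarily
late flat slabs.** Under horizon normalisation, every point causally below an old d.o.c. hole slab of chart time
`τ₁ > τ₀`, or in an old d.o.c.-certified hole tube after `τ₁`, lies in `J⁻(Ψ₀({x⁰ = σ}))` for some `σ ≥ σ₀`, for every
`σ₀`: the slab / tube point is a late d.o.c.-part chart point (§1), which `IsHorizonNormalised` puts in `J⁻` of a late flat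
slab, and `J⁻` is transitive (§2). [folklore] -/
theorem docHole_causalPast_flatSlab : ∀ {𝓢 : Spacetime.{0} 4} {O : Set 𝓢.carrier} {k : ℕ} (d : StationaryFinalStateDecomposition 𝓢 O k) (R : Fin d.N → ℝ → ℝ) {τ₁ : ℝ}, d.toOver.τ₀ < τ₁ → IsHorizonNormalised d → ∀ p ∈ 𝓢.metric.causalPast 𝓢.timeOrientation (docHoleSlabs d R τ₁) ∪ docHoleTubes d R τ₁, ∀ σ₀ : ℝ, ∃ σ : ℝ, σ₀ ≤ σ ∧ p ∈ 𝓢.metric.causalPast 𝓢.timeOrientation (d.toOver.flatChart '' (Minkowski.backgroundOn d.toOver.flatDomain).timeSlab σ) := by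
  intro 𝓢 O k d R τ₁ hτ hnorm p hp σ₀
  rcases hp with hp | hp
  · obtain ⟨q, hq, hpq⟩ := exists_mem_causalPast_singleton_of_mem_causalPast hp
    obtain ⟨i, hqi⟩ := mem_iUnion.1 (docHoleSlabs_subset_iUnion d R hτ hq)
    obtain ⟨x, hx, hxq⟩ := hqi
    obtain ⟨σ, hσ, hxσ⟩ := hnorm i x hx σ₀
    rw [hxq] at hxσ
    exact ⟨σ, hσ, causalPast_subset_causalPast_of_subset (WithTop.coe_le_coe.mpr le_top)
        (singleton_subset_iff.2 hxσ) hpq⟩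
  · obtain ⟨i, hpi⟩ := mem_iUnion.1 (docHoleTubes_subset_iUnion d R hτ.le hp)
    obtain ⟨x, hx, hxp⟩ := hpi
    obtain ⟨σ, hσ, hxσ⟩ := hnorm i x hx σ₀
    rw [hxp] at hxσ
    exact ⟨σ, hσ, hxσ⟩

/-- **Registered helper `docHole_subset_causalPast_recutCertifiedLate` — the left-hand side of the junction core lies
in `J⁻` of the recut certified LATE region, whatever the recut.** For `τ₁ > τ₀` and every `M, a, Θ, R'`:
`J⁻(docHoleSlabs d R τ₁) ∪ docHoleTubes d R τ₁ ⊆ J⁻(recutCertifiedLate d M a Θ R' τ₁)` (a flat slab of time `σ ≥ τ₁ + 1`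
lies in the flat late region after `τ₁`, a piece of `recutCertifiedLate`). So on these points the junction core
`… \ recutCertifiedLate ⊆ J⁻(recutCertifiedSlab)` is the past-boundary property of the recut certified late region.
[folklore] -/
theorem docHole_subset_causalPast_recutCertifiedLate : ∀ {𝓢 : Spacetime.{0} 4} {O : Set 𝓢.carrier} {k : ℕ} (d : StationaryFinalStateDecomposition 𝓢 O k) (M a : Fin d.N → ℝ) (Θ : Fin d.N → E4 → E4) (R R' : Fin d.N → ℝ → ℝ) {τ₁ : ℝ}, d.toOver.τ₀ < τ₁ → IsHorizonNormalised d → 𝓢.metric.causalPast 𝓢.timeOrientation (docHoleSlabs d R τ₁) ∪ docHoleTubes d R τ₁ ⊆ 𝓢.metric.causalPast 𝓢.timeOrientation (recutCertifiedLate d M a Θ R' τ₁) := by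
  intro 𝓢 O k d M a Θ R R' τ₁ hτ hnorm p hp
  obtain ⟨σ, hσ, hpσ⟩ := docHole_causalPast_flatSlab d R hτ hnorm p hp (τ₁ + 1)
  refine LorentzianMetric.causalFuture_mono ?_ hpσ
  rintro _ ⟨z, hz, rfl⟩
  refine Or.inl (mem_image_of_mem _ ?_)
  have hzσ : (Minkowski.backgroundOn d.toOver.flatDomain).time z.1 = σ := hz
  show τ₁ < (Minkowski.backgroundOn d.toOver.flatDomain).time z.1
  rw [hzσ]
  linarith

/-! ## §4 The no-hole case of the registered text -/

/-- **Registered helper `recutJunctionCore_of_N_eq_zero`**: the registered text of `stub_recutJunctionCore`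
(`RecutJunctionCore`) with the extra hypothesis `d.N = 0`. With no hole both old d.o.c. hole sets are empty and
`J⁻(∅) = ∅`, so the core inclusion is `∅ ⊆ _` for every `s, W, τ₁` (thresholds `s₁ = 0`, `τJ = 0`). The content of the
stub is entirely in `N ≥ 1`. [folklore] -/
theorem recutJunctionCore_of_N_eq_zero : ∀ (X : Type) [TopologicalSpace X] [ChartedSpace E3 X] [IsManifold (𝓡 3) ∞ X] [T2Space X] [SecondCountableTopology X] [ConnectedSpace X] (D : InitialDataSet (𝓡 3) X) (𝒟 : VacuumCauchyDevelopment D) (O : Set 𝒟.carrier) (d : StationaryFinalStateDecomposition 𝒟.toSpacetime O 2) (M a c r₀ : Fin d.N → ℝ) (Θ : Fin d.N → E4 → E4) (R : Fin d.N → ℝ → ℝ), d.N = 0 → O = Summit.FinalStateConjecture.exteriorOf 𝒟.toCauchyDevelopment d.charted → (∀ i, Tendsto (fun τ ↦ 𝒟.toSpacetime.truncDeviationCk (d.background i) (d.toOver.chart i) 2 (R i τ) τ) atTop (𝓝 0)) → (∀ i, Monotone (R i)) → (∀ i, Tendsto (R i) atTop atTop) → (∀ i, ∀ W s₀ : ℝ,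 ∀ᶠ σ in atTop, d.toOver.chart i '' ({x | (d.background i).time x.1 = σ ∧ R i (σ - s₀) - W ≤ (d.background i).radius x.1} ∩ docPart d i) ⊆ d.toOver.radiationZone) → (∀ τ₁ : ℝ, d.toOver.τ₀ < τ₁ → (O ∩ 𝒟.metric.chronologicalPast 𝒟.timeOrientation (docCharted d)) \ docCertifiedLate d R τ₁ ⊆ 𝒟.metric.causalPast 𝒟.timeOrientation (docCertifiedSlab d R τ₁)) → IsHorizonNormalised d → (∀ i, (d.hole i).horizon ⊆ Set.range (d.adapted i).toFun ∧ ChartIsAsymptoticallyCartesian (d.adapted i) ∧ InTelescope (d.hole i)) → (∀ i, IsKerrChartedWith (d.hole i) (d.adapted i) (M i) (a i) (c i) (r₀ i) (Θ i)) → ∃ s₁ : ℝ, ∀ s W : ℝ, s₁ ≤ s → s₁ ≤ W → ∃ τJ : ℝ, ∀ τ₁ : ℝ, τJ < τ₁ → (𝒟.metric.causalPast 𝒟.timeOrientation (docHoleSlabs d R τ₁) ∪ docHoleTubes d R τ₁) \ recutCertifiedLate d M a Θ (fun i τ ↦ R i (c i * τ - s) - W) τ₁ ⊆ 𝒟.metric.causalPast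 𝒟.timeOrientation (recutCertifiedSlab d M a Θ (fun i τ ↦ R i (c i * τ - s) - W) τ₁) := by
  intro X _ _ _ _ _ _ D 𝒟 O d M a c r₀ Θ R hN _ _ _ _ _ _ _ _ _
  haveI : IsEmpty (Fin d.N) := ⟨fun i ↦ (Fin.cast hN i).elim0⟩
  refine ⟨0, fun s W _ _ ↦ ⟨0, fun τ₁ _ ↦ ?_⟩⟩
  rw [docHoleSlabs_eq_empty, docHoleTubes_eq_empty, causalPast_empty, empty_union, Set.empty_sdiff]
  exact empty_subset _

end Summit.FinalStateConjecture.FinalStateConjecture.Theorems.SymplecticDualOfTheBomb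

end
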